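import Literature.NumberTheory.EllipticCurves.Hsieh2012.NonvanishingHeckeLValuesModP
import HarnessLib

/-!
# Hsieh 2012 (Amer. J. Math. 134), §6 — bookkeeping for the statement file
# `NonvanishingHeckeLValuesModP.lean`

Proof file (theorems only, no new definition, no named fact, nothing asserted beyond what is
proved): the elementary relations between the typed objects of the statement file —
Remark 6.9 (1) implies Theorem 6.8 as typed (drop (C)); Hsieh's family `X⁻_𝔩`
(`lPowerAnticyclotomicFamily`) contains `1` and is closed under inverses and products (it is the
character group of `Γ⁻`) and consists of finite-order characters; and the consumer shape of (NV):
granted that `X⁻_𝔩` is infinite, some `ν ∈ X⁻_𝔩` has all its normalised values of `p`-adic norm `1`.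
BSD is not touched.

References: [Hsieh2012] M.-L. Hsieh, Amer. J. Math. 134 (2012) = arXiv:1208.4751, p. 1 ((NV),
`X⁻_𝔩`), Thm. 6.8, Rem. 6.9 (1).
-/

noncomputable section

open scoped Classical
open NumberField IsDedekindDomain
open Literature.NumberTheory.GaloisRepresentations

namespace Literature.NumberTheory.EllipticCurves.Hsieh2012

/-! ### §3. Bookkeeping -/

section API

variable {K : Type} [Field K] [NumberField K] [IsCMField K] {p : ℕ} [Fact p.Prime]

/-- Remark 6.9 (1) is the stronger statement: dropping (C) from the hypotheses of Theorem 6.8.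
[cite: Hsieh2012, Remark 6.9 (1) (p. 24)] -/
theorem thmA_of_rem69 (h : rem69_NV_of_isSelfDual) : thmA_NV_of_isSelfDual := by
  intro p _ hp K _ _ _ hunr ι Sp hSp ℓ 𝔏 hℓ hℓp h𝔏 hsplit he hf χ κ hχ hsd hCp hC𝔏 hC𝔏' hL hR _
  exact h p hp K hunr ι Sp hSp ℓ 𝔏 hℓ hℓp h𝔏 hsplit he hf χ κ hχ hsd hCp hC𝔏 hC𝔏' hL hR

/-- Members of `X⁻_𝔩` have finite order (`ν^{ℓⁿ} = 1`, `ℓ ≥ 1`), hence are unitary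
(`HeckeCharacter.IsFiniteOrder.isUnitary`). [cite: Hsieh2012, p. 1 (X⁻_𝔩 = finite order characters of Γ⁻)] -/
theorem isFiniteOrder_of_mem_lPowerAnticyclotomicFamily {ℓ : ℕ} (hℓ : 0 < ℓ)
    {𝔏 : HeightOneSpectrum (𝓞 K)} {ν : HeckeCharacter K}
    (hν : ν ∈ lPowerAnticyclotomicFamily ℓ 𝔏) : ν.IsFiniteOrder := by
  obtain ⟨⟨n, hn⟩, -, -⟩ := hν
  exact isOfFinOrder_iff_pow_eq_one.mpr ⟨ℓ ^ n, pow_pos hℓ n, hn⟩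

/-- The trivial character lies in `X⁻_𝔩` (the identity of `Γ⁻`-characters). [cite: Hsieh2012, p. 1 (X⁻_𝔩)] -/
theorem one_mem_lPowerAnticyclotomicFamily (ℓ : ℕ) (𝔏 : HeightOneSpectrum (𝓞 K)) :
    (1 : HeckeCharacter K) ∈ lPowerAnticyclotomicFamily ℓ 𝔏 := by
  refine ⟨⟨0, by simp⟩, HeckeCharacter.ext fun x ↦ by simp, fun w _ _ u ↦ ?_⟩
  simp [HeckeCharacter.localComponent_apply]

/-- `X⁻_𝔩` is closed under inverses (it is the character group of `Γ⁻`). [cite: Hsieh2012, p. 1 (X⁻_𝔩)] -/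
theorem inv_mem_lPowerAnticyclotomicFamily {ℓ : ℕ} {𝔏 : HeightOneSpectrum (𝓞 K)}
    {ν : HeckeCharacter K} (hν : ν ∈ lPowerAnticyclotomicFamily ℓ 𝔏) :
    ν⁻¹ ∈ lPowerAnticyclotomicFamily ℓ 𝔏 := by
  obtain ⟨⟨n, hn⟩, hc, hu⟩ := hν
  refine ⟨⟨n, by rw [inv_pow, hn, inv_one]⟩, ?_, fun w hw hw' ↦ (hu w hw hw').inv'⟩
  rw [HeckeCharacter.galConj_inv, hc]

/-- `X⁻_𝔩` is closed under products (it is the character group of `Γ⁻`). [cite: Hsieh2012, p. 1 (X⁻_𝔩)] -/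
theorem mul_mem_lPowerAnticyclotomicFamily {ℓ : ℕ} {𝔏 : HeightOneSpectrum (𝓞 K)}
    {ν μ : HeckeCharacter K} (hν : ν ∈ lPowerAnticyclotomicFamily ℓ 𝔏)
    (hμ : μ ∈ lPowerAnticyclotomicFamily ℓ 𝔏) : ν * μ ∈ lPowerAnticyclotomicFamily ℓ 𝔏 := by
  obtain ⟨⟨n, hn⟩, hc, hu⟩ := hν
  obtain ⟨⟨m, hm⟩, hc', hu'⟩ := hμ
  refine ⟨⟨n + m, ?_⟩, ?_, fun w hw hw' ↦ (hu w hw hw').mul' (hu' w hw hw')⟩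
  · rw [mul_pow, pow_add, pow_mul, hn, one_pow, mul_comm (ℓ ^ n), pow_mul, hm, one_pow, one_mul]
  · rw [HeckeCharacter.galConj_mul, hc, hc', mul_inv]

/-- Under (NV) the exceptional set is finite; in particular, granted that `X⁻_𝔩` is infinite, some
`ν ∈ X⁻_𝔩` has all its continuation values of norm exactly `1` (units, outside `𝔪`) — the shape
"there is a twist with non-vanishing `L`-value mod `p`" in which consumers use (NV).
[cite: Hsieh2012, p. 1 ((NV))] -/
theorem NV.exists_forall_norm_eq_one {ι : PadicAlgCl p ≃+* ℂ} {ℓ : ℕ} {𝔏 : HeightOneSpectrum (𝓞 K)}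
    {χ : HeckeCharacter K} {k : ℕ} {κ : InfinitePlace K → ℕ} (h : NV ι ℓ 𝔏 χ k κ)
    (hinf : (lPowerAnticyclotomicFamily (K := K) ℓ 𝔏).Infinite) :
    ∃ Ω : InfinitePlace K → ℂ, (∀ w, Ω w ≠ 0) ∧ ∃ ν ∈ lPowerAnticyclotomicFamily ℓ 𝔏,
      ∀ hL : LFunction.HasEntireContinuation (heckeLFunction (χ * ν)),
        ‖ι.symm (algebraicLValue k κ Ω 𝔏 (χ * ν) (hL.continuation 0))‖ = 1 := by
  obtain ⟨Ω, hΩ, hint, hfin⟩ := h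
  refine ⟨Ω, hΩ, ?_⟩
  obtain ⟨ν, hν, hνnot⟩ := (hinf.sdiff hfin).nonempty
  refine ⟨ν, hν, fun hL ↦ le_antisymm (hint ν hν hL) ?_⟩
  by_contra hlt
  exact hνnot ⟨hν, hL, lt_of_not_ge hlt⟩

/-- (NV) is monotone in nothing but itself; restated: the integrality clause alone, for the record —
every continuation value of every `L^{alg,𝔩}(0, χν; Ω)` is `p`-integral under `ι⁻¹`.
[cite: Hsieh2012, p. 1 ("It is known that L^{alg,𝔩}(0, χν) ∈ Z̄_(p)")] -/
theorem NV.norm_le_one {ι : PadicAlgCl p ≃+* ℂ} {ℓ : ℕ} {𝔏 : HeightOneSpectrum (𝓞 K)}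
    {χ : HeckeCharacter K} {k : ℕ} {κ : InfinitePlace K → ℕ} (h : NV ι ℓ 𝔏 χ k κ) :
    ∃ Ω : InfinitePlace K → ℂ, (∀ w, Ω w ≠ 0) ∧ ∀ ν ∈ lPowerAnticyclotomicFamily ℓ 𝔏,
      ∀ hL : LFunction.HasEntireContinuation (heckeLFunction (χ * ν)),
        ‖ι.symm (algebraicLValue k κ Ω 𝔏 (χ * ν) (hL.continuation 0))‖ ≤ 1 := by
  obtain ⟨Ω, hΩ, hint, -⟩ := h
  exact ⟨Ω, hΩ, hint⟩

end API

end Literature.NumberTheory.EllipticCurves.Hsieh2012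

end
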